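import Summits.MatrixMultiplication.OmegaCensus.DominoZ17StructSixArrA0
import HarnessLib

/-!
# The `y`-arrangement list of family `A` for the structural part-`6` route, `p = 17`: completeness decides, part 2 of 6 (independent of the other parts)

ω-census `pub-omega`, family (b3), seat pub-omega-group gen 25.  Framing: lottery ticket; floor = certified bounds/negative
ranges.  VALUE: per-prime kernel data of the structural part-`6` route WITHOUT the pigeonhole (`DominoZpZpStructSixWide*.lean`)
for `p = 17` — target: the OPEN census cell `(1,6,16)@289` (`A = ℤ₁₇²`) and every larger order with such a quotient; NOT progress on ω.

Per-representative kernel decides `(arr6Y3 17 k).all (· ∈ ysaZ17s6)` for 12 representatives.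
-/

namespace Summit.MatrixMultiplication.OmegaCensus

open ZpZpDomino

namespace ZpZpDomino

/-- Completeness at representative 12. [folklore] -/
theorem ysaZ17s6_c12 : ((arr6Y3 17 [0,0,0,0,0,0,0,0,0,0,0,1,2,2,1,0,0]).all fun ys => ysaZ17s6.contains ys) = true := by decide +kernel

/-- Completeness at representative 13. [folklore] -/
theorem ysaZ17s6_c13 : ((arr6Y3 17 [0,0,0,0,0,0,0,0,0,0,1,0,0,1,2,1,1]).all fun ys => ysaZ17s6.contains ys) = true := by decide +kernel

/-- Completeness at representative 14. [folklore] -/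
theorem ysaZ17s6_c14 : ((arr6Y3 17 [0,0,0,0,0,0,0,0,0,0,1,0,1,1,1,0,2]).all fun ys => ysaZ17s6.contains ys) = true := by decide +kernel

/-- Completeness at representative 15. [folklore] -/
theorem ysaZ17s6_c15 : ((arr6Y3 17 [0,0,0,0,0,0,0,0,0,0,1,0,2,0,2,0,1]).all fun ys => ysaZ17s6.contains ys) = true := by decide +kernel

/-- Completeness at representative 16. [folklore] -/
theorem ysaZ17s6_c16 : ((arr6Y3 17 [0,0,0,0,0,0,0,0,0,0,1,1,1,2,1,0,0]).all fun ys => ysaZ17s6.contains ys) = true := by decide +kernel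

/-- Completeness at representative 17. [folklore] -/
theorem ysaZ17s6_c17 : ((arr6Y3 17 [0,0,0,0,0,0,0,0,0,0,1,1,2,1,1,0,0]).all fun ys => ysaZ17s6.contains ys) = true := by decide +kernel

/-- Completeness at representative 18. [folklore] -/
theorem ysaZ17s6_c18 : ((arr6Y3 17 [0,0,0,0,0,0,0,0,0,0,1,2,2,1,0,0,0]).all fun ys => ysaZ17s6.contains ys) = true := by decide +kernel

/-- Completeness at representative 19. [folklore] -/
theorem ysaZ17s6_c19 : ((arr6Y3 17 [0,0,0,0,0,0,0,0,0,0,2,1,2,1,0,0,0]).all fun ys => ysaZ17s6.contains ys) = true := by decide +kernel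

/-- Completeness at representative 20. [folklore] -/
theorem ysaZ17s6_c20 : ((arr6Y3 17 [0,0,0,0,0,0,0,0,0,1,0,0,0,1,2,2,0]).all fun ys => ysaZ17s6.contains ys) = true := by decide +kernel

/-- Completeness at representative 21. [folklore] -/
theorem ysaZ17s6_c21 : ((arr6Y3 17 [0,0,0,0,0,0,0,0,0,1,0,1,2,0,1,1,0]).all fun ys => ysaZ17s6.contains ys) = true := by decide +kernel

/-- Completeness at representative 22. [folklore] -/
theorem ysaZ17s6_c22 : ((arr6Y3 17 [0,0,0,0,0,0,0,0,0,1,1,0,0,1,1,2,0]).all fun ys => ysaZ17s6.contains ys) = true := by decide +kernel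

/-- Completeness at representative 23. [folklore] -/
theorem ysaZ17s6_c23 : ((arr6Y3 17 [0,0,0,0,0,0,0,0,0,1,1,1,2,0,1,0,0]).all fun ys => ysaZ17s6.contains ys) = true := by decide +kernel

end ZpZpDomino

end Summit.MatrixMultiplication.OmegaCensus
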